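import Summits.RiemannHypothesis.RiemannHypothesis.Theorems.WeilFormatCDataRungGeneric
import Summits.RiemannHypothesis.RiemannHypothesis.Theorems.WeilFormatCTailEvenJMatrix
import Summits.RiemannHypothesis.RiemannHypothesis.Theorems.WeilFormatCTailOddJMatrix
import Literature.NumberTheory.LFunctions.YoshidaWindowGramFrontDoorJ
import Summits.RiemannHypothesis.RiemannHypothesis.Theorems.WeilFormatCDataKitW
import HarnessLib

/-!
# Format C: the KERNEL front door, GENERIC in the tail — data kit for `weilPositivityOn_of_formatC_kernels`

Helper file of the rh-explicit Weil-positivity programme (`--supports stmt-RiemannHypothesis-0098`; seat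
rh-explicit-weil-2), RH-free, no definitions, no named facts.  It composes weil-10's GENERIC data front door
`WeilFormatC.weilPositivityOn_of_formatC_kernels` (tail matrices `U₂⁺`, `U₂⁻` abstracted behind their majorant premises) with
weil-2's kernel evaluator: every hypothesis except the two tail majorant premises is (i) a validity fact delivered by a
`decide +kernel` data certificate, (ii) an entrywise enclosure `near` of the per-sector Schur matrix
`M − Σ_cols/w − U₂` against integer midpoints (from `Encl.near_front_of_checkAux(W)` with ANY kernel box of `U₂` — order 1:
`u2EvenBox`, order J: `u2EvenJBox`, mean-square tail: the next part), (iii) a `PsdDyadic.checkPsdMid` verdict, or (iv) an integer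
comparison of a box endpoint; the tail enters ONLY through the real functions `U2E`, `U2O : ℕ → ℕ → ℝ` and their majorant
premises (`hU2E`, `hU2O` — literally the conclusions of weil-10's `*_tail*_majorant_matrix` lemmas after the `Fin` bridge, e.g.
`U2EvenJ_majorant` below).  So a new tail lever costs one box file + one bridge lemma, no new kit.
-/

set_option linter.dupNamespace false
set_option autoImplicit false

noncomputable section

open Complex Finset Matrix
open scoped Real BigOperators ArithmeticFunction.vonMangoldt

namespace Summit.RiemannHypothesis.RiemannHypothesis.Theorems.WeilFormatC

open Literature.NumberTheory.LFunctions Literature.NumberTheory.LFunctions.Yoshida1992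
  Literature.NumberTheory.LFunctions.Yoshida1992.Encl Literature.Analysis.SpecialFunctions
  Literature.Analysis.ValidatedNumerics.NumericsMP

variable {a : ℝ} {S : ℕ} {ks : List PrimeLen} {C : Consts} {F : FDConsts}

/-- **`WeilPositivityOn a` from the GENERIC data kit.**  All hypotheses except the tail majorant premises `hU2E`/`hU2O`
are delivered by `decide +kernel` certificates of the generated rung files (validity of constants / front-door constants /
prime data / tables, the two `near` enclosures against the chosen tail `U2E`/`U2O`, the odd column weights, the two `PsdDyadic`
verdicts) or are integer comparisons of box endpoints. -/
theorem weilPositivityOn_of_kitG (ha : 0 < a) (hS : 0 < S) (hC : ConstsValid S a ks C)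
    (hF : FDValid S a F) {tab : List IdxRec}
    -- EVEN sector
    {Be B3e : ℕ} (hBe : 2 ≤ Be) (hBBe : Be ≤ B3e) (hTe : TabValid S a ks (Be + 1) tab) {ctabE : List IdxRec}
    (hCTe : TabColValid S a ks Be (B3e + 1) ctabE)
    {ce cde wze d0ze pe qe : ℕ} (hwze : 0 < wze) (hd0ze : 0 < d0ze) (hsqe : checkSqrtUpper 8 (Be - 1) pe qe = true)
    (h0e : 0 < (devEvenBox S C F (tget tab Be) Be pe qe).lo)
    (hwe : (wze : ℤ) * (S : ℤ) ≤ (devEvenBox S C F (tget tab Be) Be pe qe).lo * 2 ^ cde)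
    (hd0e : (d0ze : ℤ) * (S : ℤ) ≤ (devEvenBox S C F (tget ctabE B3e) B3e pe qe).lo * 2 ^ cde)
    (U2E : ℕ → ℕ → ℝ)
    (hU2E : ∀ d : ℕ → ℝ, (∀ m, B3e ≤ m → (d0ze : ℝ) * (1 / 2 ^ cde) ≤ d m) → ∀ (N : ℕ) (x : Fin Be → ℝ),
      ∑ m ∈ Finset.Ico B3e N, (∑ i : Fin Be, (if (i : ℕ) = 0 then gramCoeff a 0 m else if m = 0 then gramCoeff a i 0
        else (gramCoeff a i m + gramCoeff a i (-(m : ℤ))) / 2) * x i) ^ 2 / d m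
        ≤ x ⬝ᵥ (Matrix.of fun i j : Fin Be ↦ U2E i j) *ᵥ x)
    {ρe δe : ℤ} {DSe Le : List (List ℤ)} (hPe : PsdDyadic.checkPsdMid Be δe ρe DSe Le = true)
    (hneare : ∀ i j : Fin Be,
      |((if (i : ℕ) = 0 then gramCoeff a 0 j else if (j : ℕ) = 0 then gramCoeff a i 0
          else (gramCoeff a i j + gramCoeff a i (-(j : ℤ))) / 2)
        - (∑ m ∈ Finset.Ico Be B3e, (if (i : ℕ) = 0 then gramCoeff a 0 m else if m = 0 then gramCoeff a i 0
            else (gramCoeff a i m + gramCoeff a i (-(m : ℤ))) / 2) *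
            (if (j : ℕ) = 0 then gramCoeff a 0 m else if m = 0 then gramCoeff a j 0
            else (gramCoeff a j m + gramCoeff a j (-(m : ℤ))) / 2) / ((fun _ : ℕ ↦ (wze : ℝ) * (1 / 2 ^ cde)) m))
        - U2E i j)
        - (PsdDyadic.getMZ DSe i j : ℝ) * (1 / 2 ^ ce)| ≤ (ρe : ℝ) * (1 / 2 ^ ce))
    -- ODD sector
    {Bo B3o : ℕ} (hBo : 1 ≤ Bo) (hBBo : Bo ≤ B3o) {ctabO : List IdxRec}
    (hCTo : TabColValid S a ks Bo (B3o + 2) ctabO)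
    {co cdo d0zo po qo Ksero qr : ℕ} {wso rso : List ℕ} (hd0zo : 0 < d0zo) (hsqo : checkSqrtUpper 8 Bo po qo = true)
    (h0o : 0 < (devOddBox S C F (tget ctabO (Bo + 1)) Bo Bo po qo).lo)
    (hWo : checkWeightsOdd S Ksero C F ctabO Bo (B3o - Bo) cdo wso rso qr po qo = true)
    (hd0o : (d0zo : ℤ) * (S : ℤ) ≤ (devOddBox S C F (tget ctabO (B3o + 1)) B3o Bo po qo).lo * 2 ^ cdo)
    (U2O : ℕ → ℕ → ℝ)
    (hU2O : ∀ d : ℕ → ℝ, (∀ l, B3o ≤ l → (d0zo : ℝ) * (1 / 2 ^ cdo) ≤ d l) → ∀ (N : ℕ) (x : Fin Bo → ℝ),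
      ∑ l ∈ Finset.Ico B3o N, (∑ k : Fin Bo, ((gramCoeff a (((k : ℕ) : ℤ) + 1) ((l : ℤ) + 1)
        - gramCoeff a (((k : ℕ) : ℤ) + 1) (-((l : ℤ) + 1))) / 2) * x k) ^ 2 / d l
        ≤ x ⬝ᵥ (Matrix.of fun k k' : Fin Bo ↦ U2O k k') *ᵥ x)
    {ρo δo : ℤ} {DSo Lo : List (List ℤ)} (hPo : PsdDyadic.checkPsdMid Bo δo ρo DSo Lo = true)
    (hnearo : ∀ k k' : Fin Bo,
      |(((gramCoeff a (((k : ℕ) : ℤ) + 1) (((k' : ℕ) : ℤ) + 1) - gramCoeff a (((k : ℕ) : ℤ) + 1) (-(((k' : ℕ) : ℤ) + 1))) / 2)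
        - (∑ l ∈ Finset.Ico Bo B3o, ((gramCoeff a (((k : ℕ) : ℤ) + 1) ((l : ℤ) + 1) - gramCoeff a (((k : ℕ) : ℤ) + 1) (-((l : ℤ) + 1))) / 2) *
            ((gramCoeff a (((k' : ℕ) : ℤ) + 1) ((l : ℤ) + 1) - gramCoeff a (((k' : ℕ) : ℤ) + 1) (-((l : ℤ) + 1))) / 2) /
              (woF wso cdo Bo l))
        - U2O k k')
        - (PsdDyadic.getMZ DSo k k' : ℝ) * (1 / 2 ^ co)| ≤ (ρo : ℝ) * (1 / 2 ^ co)) :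
    WeilPositivityOn a := by
  have hSr : (0 : ℝ) < S := by exact_mod_cast hS
  -- EVEN numeric facts
  have hBe1 : 1 ≤ Be := by omega
  have hreBe : MI.mem S (reDigammaQuarter (freq a Be)) (tget tab Be).reP := (hTe Be (by omega)).2.reP
  have hreB3e : MI.mem S (reDigammaQuarter (freq a B3e)) (tget ctabE B3e).reP := (hCTe B3e (by omega) (by omega)).2
  have hloBe := devEvenBox_lo_le hS ha hC hF hreBe (by omega) hsqe
  have hloB3e := devEvenBox_lo_le hS ha hC hF hreB3e (by omega) hsqe
  have h0e' : 0 < devEven a Be Be := by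
    have : (0 : ℝ) < (devEvenBox S C F (tget tab Be) Be pe qe).lo := by exact_mod_cast h0e
    nlinarith
  have hwe' : (wze : ℝ) * (1 / 2 ^ cde) ≤ devEven a Be Be := dyadic_le_of_lo hS hwe hloBe
  have hd0e' : (d0ze : ℝ) * (1 / 2 ^ cde) ≤ devEven a Be B3e := dyadic_le_of_lo hS hd0e hloB3e
  have hwpos : (0 : ℝ) < (wze : ℝ) * (1 / 2 ^ cde) := by positivity
  have hd0pos : (0 : ℝ) < (d0ze : ℝ) * (1 / 2 ^ cde) := by positivity
  -- ODD numeric facts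
  have hreBo : MI.mem S (reDigammaQuarter (freq a ((Bo : ℤ) + 1))) (tget ctabO (Bo + 1)).reP := by
    have h := (hCTo (Bo + 1) (by omega) (by omega)).2
    push_cast at h; exact h
  have hreB3o : MI.mem S (reDigammaQuarter (freq a ((B3o : ℤ) + 1))) (tget ctabO (B3o + 1)).reP := by
    have h := (hCTo (B3o + 1) (by omega) (by omega)).2
    push_cast at h; exact h
  have hloBo := devOddBox_lo_le hS ha hC hF hreBo (by omega) hsqo
  have hloB3o := devOddBox_lo_le hS ha hC hF hreB3o (by omega) hsqo
  have h0o' : 0 < devOdd0 a Bo Bo := by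
    have : (0 : ℝ) < (devOddBox S C F (tget ctabO (Bo + 1)) Bo Bo po qo).lo := by exact_mod_cast h0o
    nlinarith
  have hd0o' : (d0zo : ℝ) * (1 / 2 ^ cdo) ≤ devOdd0 a Bo B3o := dyadic_le_of_lo hS hd0o hloB3o
  have hd0opos : (0 : ℝ) < (d0zo : ℝ) * (1 / 2 ^ cdo) := by positivity
  have hWts := weights_of_checkOdd hS ha hC hF (by omega) hsqo hCTo (by omega) hWo
  refine weilPositivityOn_of_formatC_kernels ha hBe hBBe (d0e := (d0ze : ℝ) * (1 / 2 ^ cde))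
    (fun _ ↦ (wze : ℝ) * (1 / 2 ^ cde)) ?_ ?_ ?_ (Matrix.of fun i j : Fin Be ↦ U2E i j) hU2E ?_
    hBo hBBo (d0o := (d0zo : ℝ) * (1 / 2 ^ cdo)) (woF wso cdo Bo) ?_ ?_ ?_ (Matrix.of fun k k' : Fin Bo ↦ U2O k k') hU2O ?_
  · -- h0e
    have h := h0e'; unfold devEven at h; exact h
  · -- hd0e
    refine ⟨hd0pos, ?_⟩
    have h := hd0e'; unfold devEven at h; exact h
  · -- hwe
    intro m hm _
    refine ⟨hwpos, ?_⟩
    have h := hwe'.trans (devEven_mono ha hBe1 hm)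
    unfold devEven at h; exact h
  · -- hSe
    intro x
    have hP := PsdDyadic.psd_of_checkPsdMid hPe (u := 1 / 2 ^ ce) (by positivity) _ (fun i j ↦ hneare i j) x
    simpa only [Matrix.of_apply] using hP
  · -- h0o
    have h := h0o'; unfold devOdd0 at h; exact h
  · -- hd0o
    refine ⟨hd0opos, ?_⟩
    have h := hd0o'; unfold devOdd0 at h; exact h
  · -- hwo (per column)
    intro l hl hlB
    have h := hWts l hl (by omega)
    unfold devOddA at h
    exact h
  · -- hSo
    intro x
    have hP := PsdDyadic.psd_of_checkPsdMid hPo (u := 1 / 2 ^ co) (by positivity) _ (fun k k' ↦ hnearo k k') x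
    simpa only [Matrix.of_apply] using hP

/-- **The order-`J` tail feeds the generic kit (even)**: weil-10's `even_tailJ_majorant_matrix` in the `hU2E` shape of
`weilPositivityOn_of_kitG` with `U2E = Encl.U2EvenJ a θ η d₀ Be B3e Je`. -/
theorem U2EvenJ_majorant (ha : 0 < a) {Be B3e : ℕ} (hBe : 1 ≤ Be) (hBBe : 2 * Be ≤ B3e) (hB3e : 2 ≤ B3e) (Je : ℕ)
    {θ η d0 : ℝ} (hθ : 0 < θ) (hη : 0 < η) (hd0 : 0 < d0) (d : ℕ → ℝ) (hd : ∀ m, B3e ≤ m → d0 ≤ d m)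
    (N : ℕ) (x : Fin Be → ℝ) :
    ∑ m ∈ Finset.Ico B3e N, (∑ i : Fin Be, (if (i : ℕ) = 0 then gramCoeff a 0 m else if m = 0 then gramCoeff a i 0
      else (gramCoeff a i m + gramCoeff a i (-(m : ℤ))) / 2) * x i) ^ 2 / d m
      ≤ x ⬝ᵥ (Matrix.of fun i j : Fin Be ↦ U2EvenJ a θ η d0 Be B3e Je i j) *ᵥ x := by
  have h := even_tailJ_majorant_matrix ha hBe hBBe hB3e Je d hd0 hd hθ hη N x
  refine h.trans (le_of_eq ?_)
  congr 2
  ext i i'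
  simp only [Matrix.of_apply]
  exact U2EvenJ_fin a θ η d0 B3e Je i i'

/-- **The order-`J` tail feeds the generic kit (odd)**: `U2O = Encl.U2OddJ a θ η d₀ Bo B3o Jo`. -/
theorem U2OddJ_majorant (ha : 0 < a) {Bo B3o : ℕ} (hBo : 1 ≤ Bo) (hBBo : 2 * Bo ≤ B3o) (Jo : ℕ)
    {θ η d0 : ℝ} (hθ : 0 < θ) (hη : 0 < η) (hd0 : 0 < d0) (d : ℕ → ℝ) (hd : ∀ l, B3o ≤ l → d0 ≤ d l)
    (N : ℕ) (x : Fin Bo → ℝ) :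
    ∑ l ∈ Finset.Ico B3o N, (∑ k : Fin Bo, ((gramCoeff a (((k : ℕ) : ℤ) + 1) ((l : ℤ) + 1)
      - gramCoeff a (((k : ℕ) : ℤ) + 1) (-((l : ℤ) + 1))) / 2) * x k) ^ 2 / d l
      ≤ x ⬝ᵥ (Matrix.of fun k k' : Fin Bo ↦ U2OddJ a θ η d0 Bo B3o Jo k k') *ᵥ x := by
  have h := odd_tailJ_majorant_matrix ha hBo hBBo Jo d hd0 hd hθ hη N x
  refine h.trans (le_of_eq ?_)
  congr 2
  ext k k'
  simp only [Matrix.of_apply]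
  exact U2OddJ_fin a θ η d0 B3o Jo k k'

end Summit.RiemannHypothesis.RiemannHypothesis.Theorems.WeilFormatC

end
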